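import Summits.Ventures.LatticeQCDFlow.Scaling.TemporalPlaquetteFloor

/-!
HONEST FRAMING: exact (Metropolis-corrected) sampling algorithms for lattice gauge theory; figures
of merit are autocorrelation/cost numbers at stated couplings and volumes; no continuum-physics
claim.

# ClusteringFloorInPlane — AT EVERY `β > 0` THE CLUSTERING FLOOR (U″) AND THE CROSS-CUT FLOORS
# (U′)_R, `R ≥ 1`, ARE ONE CONJECTURE ALONG AN IN-PLANE AXIS TOO — HENCE ALONG EVERY AXIS
# (lean-1 GEN-12, ours; part 3 of 3)

Venture-side (OURS). Cell `lqcd-flow` (pub-lqcd), unit `pub-lqcd-lean-1-g12`, 2026-08-23.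
GEN-11's structure theorem (`CrossCutFloorAnySeparation.clusteringFloor_iff_crossCut`):
for continuous `ρ`, `β > 0` and a TRANSVERSE axis `a ∉ {i, j}`,
`Conjectures.ClusteringFloor d N G ρ β i j a ↔ Conjectures.CrossCutCorrelatorFloor d N G ρ β R i j a`
for every `R`.  Its NOT-CLAIMED item was the IN-PLANE axis `a ∈ {i, j}`: there the two
plaquettes are, after an axis permutation, temporal plaquettes `(x; 0, j)` separated in time, and
reflection positivity makes their truncated correlator `G` log-convex only from separation `2` on
(`TemporalPlaquetteFloor.sq_tCorr_le_temporal`; `G(1)² ≤ G(0)G(2)` is not an instance).  This file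
closes the item as far as the mechanism allows:

* `clusteringFloor_of_crossCut_inPlane_time` — time axis, temporal orientation `(0, j)`, `j ≠ 0`,
  **`R ≥ 1`**: `CrossCutCorrelatorFloor d N G ρ β R 0 j 0 → ClusteringFloor d N G ρ β 0 j 0`
  (`κ₀ = δ`, `ξ = 1/log(2N²/δ + 2)`, `L₀' = max L₀ (4R + 2)`: the floor at separation `2R + 1 ≥ 3`
  forces `δ ≤ G(2)` by `tCorr_two_ge_of_abs_temporal`, then `G(n) ≥ δ(δ/N²)ⁿ` by
  `tCorr_ge_geometric_temporal`);
* `clusteringFloor_of_crossCut_inPlane` — the same for every plane `i ≠ j` and in-plane axis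
  `a = i` or `a = j` (axis permutation `Equiv.swap 0 i` and orientation reversal, gen-11's
  `crossCutCorrelatorFloor_perm/_swap`, `clusteringFloor_perm/_swap`);
* **`clusteringFloor_iff_crossCut_inPlane`** — `ClusteringFloor d N G ρ β i j a ↔
  CrossCutCorrelatorFloor d N G ρ β R i j a` for `a ∈ {i, j}`, every `R ≥ 1`, `β > 0`;
* **`clusteringFloor_iff_crossCut_anyAxis`** — combined with gen-11: for EVERY plane `i ≠ j`,
  EVERY axis `a` and every `R ≥ 1`, (U″) ⇔ (U′)_R at each `β > 0`; and
  `crossCutCorrelatorFloor_iff_of_sep_anyAxis` — (U′)_R ⇔ (U′)_{R'} for `R, R' ≥ 1`;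
* `conjCorr_ge_geometric_inPlane` — the signed, explicit-rate form on ONE torus (`L ≥ 4`,
  `β ≥ 0`): a floor `δ ≤ |⟨P_y P_{y+m e₀}⟩ − ⟨P_y⟩⟨P_{y+m e₀}⟩|` at one in-plane separation
  `2 ≤ m ≤ (L+1)/2` and every site of this torus forces
  `δ(δ/N²)^s ≤ ⟨P_x P_{x+s e₀}⟩ − ⟨P_x⟩⟨P_{x+s e₀}⟩` (positive sign) for every `s ≤ L − 1`;
* repaired forms (`…R`).

So THEORY-2's ledger shrinks once more: at each `β > 0`, for every plane and EVERY axis, the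
hypotheses (U′)_R (`R ≥ 1`) and (U″) are ONE conjecture.  What is different in-plane: (U′)_0
(separation one) is implied by (U″) (`crossCutCorrelatorFloor_of_clusteringFloor`, any axis) but is
NOT shown to imply it — a floor on `G(1)` alone gives no handle on `G(2)/G(1)`.
NOT CLAIMED: in-plane (U′)_0 ⇒ (U″); `β ≤ 0`; any VALUE of an in-plane floor — in particular NO
strong-coupling in-plane theorem: the tree's one-link / slab-chain floors (gens 8–10,
`crossCutCorrelatorFloor_of_oneLink`) stack spatial plaquettes along a transverse axis, and the
in-plane leading coefficient (a `3 × 1 × 1` box, order `β^{12}` at separation `2`) is not in the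
tree.  Literature grade (cell rule): known mechanism (reflection positivity ⇒ log-convexity); new
docking (the venture's (U′)/(U″) unified along every axis).
-/

noncomputable section

namespace Summit.Ventures.LatticeQCDFlow.Theory2.Clustering

open MeasureTheory Literature.MathematicalPhysics.QuantumFieldTheory
open Summit.Ventures.LatticeQCDFlow.Conjectures

/-! ## §1 On one torus: the signed explicit-rate floor along an in-plane axis -/

section Torus

variable {d L N : ℕ} [NeZero d] [NeZero L] {G : Type} [Group G] [TopologicalSpace G]
  [IsTopologicalGroup G] [CompactSpace G] [MeasurableSpace G] [BorelSpace G]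
  [SecondCountableTopology G] (ρ : G →* Matrix (Fin N) (Fin N) ℂ)

/-- **SIGNED, EXPLICIT-RATE IN-PLANE CLUSTERING FLOOR ON ONE TORUS** (`L ≥ 4`, `β ≥ 0`, continuous
`ρ`, temporal orientation `(0, j)`, `j ≠ 0`): if at ONE in-plane separation `2 ≤ m ≤ (L+1)/2` the
truncated correlator is bounded below in absolute value by `δ > 0` at every site of this torus, then
`δ·(δ/N²)^s ≤ ⟨P_x P_{x + s e₀}⟩ − ⟨P_x⟩⟨P_{x + s e₀}⟩` — with the POSITIVE sign — for every site
`x` and every `s ≤ L − 1`. -/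
theorem conjCorr_ge_geometric_inPlane (hL4 : 4 ≤ L) (hρ : Continuous ρ) {β : ℝ} (hβ : 0 ≤ β)
    {j : Fin d} (hj : j ≠ 0) {m : ℕ} (hm2 : 2 ≤ m) (hm : 2 * m ≤ L + 1) {δ : ℝ} (hδ : 0 < δ)
    (hfl : ∀ y : Site d L, δ ≤ |wilsonExpectation ρ β (fun U : GaugeConfig d L G =>
        (ρ (plaquetteHolonomy U y 0 j)).trace.re
          * (ρ (plaquetteHolonomy U (y + Pi.single 0 ((m : ℕ) : ZMod L)) 0 j)).trace.re)
      - wilsonExpectation ρ β (fun U : GaugeConfig d L G => (ρ (plaquetteHolonomy U y 0 j)).trace.re)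
        * wilsonExpectation ρ β (fun U : GaugeConfig d L G =>
          (ρ (plaquetteHolonomy U (y + Pi.single 0 ((m : ℕ) : ZMod L)) 0 j)).trace.re)|)
    (x : Site d L) {s : ℕ} (hs : s + 1 ≤ L) :
    δ * (δ / (N : ℝ) ^ 2) ^ s ≤
      wilsonExpectation ρ β (fun U : GaugeConfig d L G =>
        (ρ (plaquetteHolonomy U x 0 j)).trace.re
          * (ρ (plaquetteHolonomy U (x + Pi.single 0 ((s : ℕ) : ZMod L)) 0 j)).trace.re)
      - wilsonExpectation ρ β (fun U : GaugeConfig d L G => (ρ (plaquetteHolonomy U x 0 j)).trace.re)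
        * wilsonExpectation ρ β (fun U : GaugeConfig d L G =>
          (ρ (plaquetteHolonomy U (x + Pi.single 0 ((s : ℕ) : ZMod L)) 0 j)).trace.re) := by
  set x₀ : Site d L := x - Pi.single (0 : Fin d) (x 0) with hx₀
  have hx₀0 : x₀ 0 = 0 := by simp [hx₀]
  have h := hfl x₀
  rw [conjCorr_eq_tCorr ρ β x₀ 0 j m] at h
  have e0 : x₀ - Pi.single (0 : Fin d) (x₀ 0) = x₀ := by rw [hx₀0, Pi.single_zero, sub_zero]
  rw [e0] at h
  have h2 := tCorr_two_ge_of_abs_temporal ρ hL4 hρ hβ hx₀0 hj hm2 hm hδ h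
  rw [conjCorr_eq_tCorr ρ β x 0 j s]
  exact tCorr_ge_geometric_temporal ρ hL4 hρ hβ hx₀0 hj hδ h2 hs

end Torus

/-! ## §2 (U′) at any in-plane `R ≥ 1` ⇒ (U″) in-plane; the equivalences -/

section Conjecture

variable {d N : ℕ} [NeZero d] {G : Type} [Group G] [TopologicalSpace G] [IsTopologicalGroup G]
  [CompactSpace G] [MeasurableSpace G] [BorelSpace G] [SecondCountableTopology G]
  (ρ : G →* Matrix (Fin N) (Fin N) ℂ)

/-- **IN-PLANE (U′) AT ANY `R ≥ 1` ⇒ IN-PLANE (U″), time axis.**  For continuous `ρ`, `β > 0`, a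
temporal orientation `(0, j)`, `j ≠ 0`, and `R ≥ 1`: the cross-cut floor at separation `2R + 1`
along the time axis implies `Conjectures.ClusteringFloor d N G ρ β 0 j 0`, with `κ₀ = δ`,
`ξ = 1/log(2N²/δ + 2)`, `L₀' = max L₀ (4R + 2)`. -/
theorem clusteringFloor_of_crossCut_inPlane_time (hρ : Continuous ρ) {β : ℝ} (hβ : 0 < β)
    {j : Fin d} (hj : j ≠ 0) {R : ℕ} (hR : 1 ≤ R)
    (hU : CrossCutCorrelatorFloor d N G ρ β R 0 j 0) : ClusteringFloor d N G ρ β 0 j 0 := by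
  obtain ⟨δ, hδ, L₀, hU⟩ := hU
  set A : ℝ := 2 * (N : ℝ) ^ 2 / δ + 2 with hA
  have hA2 : 2 ≤ A := by
    have : 0 ≤ 2 * (N : ℝ) ^ 2 / δ := by positivity
    linarith
  have hApos : 0 < A := by linarith
  have hlog : 0 < Real.log A := Real.log_pos (by linarith)
  refine ⟨δ, hδ, 1 / Real.log A, by positivity, max L₀ (4 * R + 2), ?_⟩
  intro L _ hL s hs x
  have hLR : 4 * R + 2 ≤ L := le_of_max_le_right hL
  have hL0 : L₀ ≤ L := le_of_max_le_left hL
  have hL4 : 4 ≤ L := by omega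
  set x₀ : Site d L := x - Pi.single (0 : Fin d) (x 0) with hx₀
  have hx₀0 : x₀ 0 = 0 := by simp [hx₀]
  -- (i) `δ ≤ G(2)` from the cross-cut floor at separation `2R + 1 ≥ 3` and log-convexity
  have h2 : δ ≤ tCorr ρ β x₀ 0 j 2 := by
    have h := hU L hL0 x₀
    rw [conjCorr_eq_tCorr ρ β x₀ 0 j (2 * R + 1)] at h
    have e0 : x₀ - Pi.single (0 : Fin d) (x₀ 0) = x₀ := by rw [hx₀0, Pi.single_zero, sub_zero]
    rw [e0] at h
    exact tCorr_two_ge_of_abs_temporal ρ hL4 hρ hβ.le hx₀0 hj (m := 2 * R + 1) (by omega)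
      (by omega) hδ h
  -- (ii) the geometric floor on this torus
  have hfloor := tCorr_ge_geometric_temporal ρ hL4 hρ hβ.le hx₀0 hj hδ h2 (n := s) (by omega)
  -- (iii) `N ≥ 1` and `1/A ≤ δ/N²`
  have hN2 : 0 < (N : ℝ) ^ 2 := by
    have := tCorr_zero_le ρ hρ β x₀ 0 j
    have := tCorr_one_le_zero ρ hρ β x₀ 0 j
    have := tCorr_two_le_one_temporal ρ hL4 hρ hβ.le hx₀0 hj (lt_of_lt_of_le hδ h2)
    linarith
  have hq : A⁻¹ ≤ δ / (N : ℝ) ^ 2 := by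
    rw [inv_eq_one_div, div_le_div_iff₀ hApos hN2, hA]
    have : (2 * (N : ℝ) ^ 2 / δ + 2) * δ = 2 * (N : ℝ) ^ 2 + 2 * δ := by field_simp
    nlinarith [this]
  -- (iv) `κ₀ e^{−s/ξ} = δ A^{−s} ≤ δ (δ/N²)^s ≤ G(s) = the conjecture's correlator`
  have hexp : Real.exp (-((s : ℝ) / (1 / Real.log A))) = (A⁻¹) ^ s := by
    rw [div_div_eq_mul_div, div_one, Real.exp_neg, Real.exp_nat_mul, Real.exp_log hApos, inv_pow]
  rw [hexp, conjCorr_eq_tCorr ρ β x 0 j s]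
  calc δ * (A⁻¹) ^ s ≤ δ * (δ / (N : ℝ) ^ 2) ^ s :=
        mul_le_mul_of_nonneg_left (pow_le_pow_left₀ (inv_nonneg.2 hApos.le) hq s) hδ.le
    _ ≤ tCorr ρ β x₀ 0 j ((s : ℕ) : ZMod L) := hfloor
    _ ≤ |tCorr ρ β x₀ 0 j ((s : ℕ) : ZMod L)| := le_abs_self _

/-- **IN-PLANE (U′) AT ANY `R ≥ 1` ⇒ IN-PLANE (U″), separation along the FIRST axis of the plane**
(`a = i`; axis permutation `Equiv.swap 0 i` to the time direction and back). -/
theorem clusteringFloor_of_crossCut_inPlane_fst (hρ : Continuous ρ) {β : ℝ} (hβ : 0 < β)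
    {i j : Fin d} (hij : i ≠ j) {R : ℕ} (hR : 1 ≤ R)
    (hU : CrossCutCorrelatorFloor d N G ρ β R i j i) : ClusteringFloor d N G ρ β i j i := by
  set π : Equiv.Perm (Fin d) := Equiv.swap 0 i with hπ
  have hπi : π i = 0 := by simp [hπ]
  have hπ0 : π 0 = i := by simp [hπ]
  have hj0 : π j ≠ 0 := by
    intro h
    have : j = π.symm 0 := by rw [← h, Equiv.symm_apply_apply]
    rw [Equiv.symm_swap, Equiv.swap_apply_left] at this
    exact hij this.symm
  have hππ : ∀ k, π (π k) = k := fun k => by simp [hπ, Equiv.swap_apply_self]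
  have hU' : CrossCutCorrelatorFloor d N G ρ β R 0 (π j) 0 := by
    have h := crossCutCorrelatorFloor_perm ρ hρ π hU
    rwa [hπi] at h
  have h0 := clusteringFloor_of_crossCut_inPlane_time ρ hρ hβ hj0 hR hU'
  have h := clusteringFloor_perm ρ hρ π h0
  rwa [hππ, hπ0] at h

/-- **IN-PLANE (U′) AT ANY `R ≥ 1` ⇒ IN-PLANE (U″), separation along the SECOND axis of the plane**
(`a = j`; orientation reversal to the first-axis case and back). -/
theorem clusteringFloor_of_crossCut_inPlane_snd (hρ : Continuous ρ) {β : ℝ} (hβ : 0 < β)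
    {i j : Fin d} (hij : i ≠ j) {R : ℕ} (hR : 1 ≤ R)
    (hU : CrossCutCorrelatorFloor d N G ρ β R i j j) : ClusteringFloor d N G ρ β i j j :=
  clusteringFloor_swap ρ hρ
    (clusteringFloor_of_crossCut_inPlane_fst ρ hρ hβ hij.symm hR (crossCutCorrelatorFloor_swap ρ hρ hU))

/-- **IN-PLANE (U′) AT ANY SINGLE `R ≥ 1` ⇒ IN-PLANE (U″)** (`β > 0`, continuous `ρ`, plane
`i ≠ j`, axis `a = i` or `a = j`). -/
theorem clusteringFloor_of_crossCut_inPlane (hρ : Continuous ρ) {β : ℝ} (hβ : 0 < β)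
    {i j a : Fin d} (hij : i ≠ j) (ha : a = i ∨ a = j) {R : ℕ} (hR : 1 ≤ R)
    (hU : CrossCutCorrelatorFloor d N G ρ β R i j a) : ClusteringFloor d N G ρ β i j a := by
  rcases ha with rfl | rfl
  · exact clusteringFloor_of_crossCut_inPlane_fst ρ hρ hβ hij hR hU
  · exact clusteringFloor_of_crossCut_inPlane_snd ρ hρ hβ hij hR hU

/-- **IN-PLANE (U″) ⇔ IN-PLANE (U′) AT `R`, FOR EVERY `R ≥ 1`** (`β > 0`, continuous `ρ`,
`i ≠ j`, `a ∈ {i, j}`). -/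
theorem clusteringFloor_iff_crossCut_inPlane (hρ : Continuous ρ) {β : ℝ} (hβ : 0 < β)
    {i j a : Fin d} (hij : i ≠ j) (ha : a = i ∨ a = j) {R : ℕ} (hR : 1 ≤ R) :
    ClusteringFloor d N G ρ β i j a ↔ CrossCutCorrelatorFloor d N G ρ β R i j a :=
  ⟨fun h => crossCutCorrelatorFloor_of_clusteringFloor ρ h R,
    fun h => clusteringFloor_of_crossCut_inPlane ρ hρ hβ hij ha hR h⟩

/-- **(U″) ⇔ (U′)_R ALONG EVERY AXIS, `R ≥ 1`.**  For continuous `ρ`, `β > 0`, every plane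
`i ≠ j`, EVERY axis `a : Fin d` and every `R ≥ 1`:
`ClusteringFloor d N G ρ β i j a ↔ CrossCutCorrelatorFloor d N G ρ β R i j a`
(transverse axes: gen-11's `clusteringFloor_iff_crossCut`, there also `R = 0`; in-plane axes: this
file). -/
theorem clusteringFloor_iff_crossCut_anyAxis (hρ : Continuous ρ) {β : ℝ} (hβ : 0 < β)
    {i j : Fin d} (hij : i ≠ j) (a : Fin d) {R : ℕ} (hR : 1 ≤ R) :
    ClusteringFloor d N G ρ β i j a ↔ CrossCutCorrelatorFloor d N G ρ β R i j a := by
  by_cases hai : a = i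
  · exact clusteringFloor_iff_crossCut_inPlane ρ hρ hβ hij (Or.inl hai) hR
  · by_cases haj : a = j
    · exact clusteringFloor_iff_crossCut_inPlane ρ hρ hβ hij (Or.inr haj) hR
    · exact clusteringFloor_iff_crossCut ρ hρ hβ hai haj R

/-- **ALL THE (U′)_R, `R ≥ 1`, ARE EQUIVALENT ALONG EVERY AXIS** at each `β > 0` (continuous `ρ`,
`i ≠ j`): `CrossCutCorrelatorFloor … R i j a ↔ CrossCutCorrelatorFloor … R' i j a`. -/
theorem crossCutCorrelatorFloor_iff_of_sep_anyAxis (hρ : Continuous ρ) {β : ℝ} (hβ : 0 < β)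
    {i j : Fin d} (hij : i ≠ j) (a : Fin d) {R R' : ℕ} (hR : 1 ≤ R) (hR' : 1 ≤ R') :
    CrossCutCorrelatorFloor d N G ρ β R i j a ↔ CrossCutCorrelatorFloor d N G ρ β R' i j a :=
  (clusteringFloor_iff_crossCut_anyAxis ρ hρ hβ hij a hR).symm.trans
    (clusteringFloor_iff_crossCut_anyAxis ρ hρ hβ hij a hR')

/-- **(U″) along every axis ⇒ (U′) at EVERY `R` along that axis** is gen-11's
`crossCutCorrelatorFloor_of_clusteringFloor`; so along every axis a floor at any ONE cut width
`R ≥ 1` gives the floor at every cut width (including `R = 0`). -/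
theorem crossCutCorrelatorFloor_all_of_sep_anyAxis (hρ : Continuous ρ) {β : ℝ} (hβ : 0 < β)
    {i j : Fin d} (hij : i ≠ j) (a : Fin d) {R : ℕ} (hR : 1 ≤ R)
    (hU : CrossCutCorrelatorFloor d N G ρ β R i j a) (R' : ℕ) :
    CrossCutCorrelatorFloor d N G ρ β R' i j a :=
  crossCutCorrelatorFloor_of_clusteringFloor ρ
    ((clusteringFloor_iff_crossCut_anyAxis ρ hρ hβ hij a hR).2 hU) R'

/-- Repaired forms: **(U′-R) at any in-plane `R ≥ 1` ⇒ (U″-R)**, and along every axis. -/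
theorem clusteringFloorR_of_crossCutR_anyAxis (hρ : Continuous ρ) {β : ℝ} {i j : Fin d}
    (a : Fin d) {R : ℕ} (hR : 1 ≤ R) (hU : CrossCutCorrelatorFloorR d N G ρ β R i j a) :
    ClusteringFloorR d N G ρ β i j a :=
  fun hd hij hβ hnt =>
    (clusteringFloor_iff_crossCut_anyAxis ρ hρ hβ hij a hR).2 (hU.floor hd hij hβ hnt)

end Conjecture

end Summit.Ventures.LatticeQCDFlow.Theory2.Clustering
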